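import Summits.CriticalPhenomena.PercolationContinuityZ3.Theorems.PercNearOneGluingNoHeavyLowerTailSunflowerChainCombPullback
import HarnessLib
import HarnessLib.Audit

/-!
# `NoHeavyLowerTail` (crux stmt-CriticalPhenomena-4575), abstract sunflower cubic: the THREE-BLOCK theorem I — reduction of COMB_chain for a
# height-two three-block quotient to the GENERIC transversal sums of monotone maps `[3]³ → M₃`, block-`0` symmetry, and petal-name normalisation

Support file (seat `prim-ineq-gen-2` gen 21; `--supports stmt-CriticalPhenomena-4575`; sequel of `…SunflowerChainCombPullback`, p272089).  No `sorry`, no named facts,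
standard axioms.  Memo: run/shared/lean/prim/prim-ineq-gen-2/THREEBLOCK-LEAN-GEN21.md (and THREEBLOCK-GEN20.md §4 for the blueprint).

CONTEXT.  `ChainComb.comb_chain_of_height_two` + `Sunflower.Zp_composeC_nonneg_of_comb` (prim-l12-p2 g9, gen 20): the partition lemma ★ (rows `H`, `G`, `T`) for EVERY
sunflower reading three disjoint blocks through monotone chain statistics of any height follows from
  `(H2)  ∀ (G : Sunflower (Σ b : Fin 3, Fin 2)) (c), 0 ≤ ZFC κ G c`   (COMB_chain of the height-two three-block quotients).
This file reduces (H2) to a statement about plain functions, which the companion `…SunflowerThreeBlockCombChecker` decides by a verified depth-first search: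

* §1 `psiOf G : ([3]³ := Fin 3 → Fin 3) → Fin 5`, the label of each staircase; it is MONOTONE into the diamond `M₃` (`IsMonoM3`, from `Sunflower.lab_mono`).
* §2 the generic transversal sums `Tgen κ ψ = Σ_{g : Fin 3 → Fin 6} κ(ψ (pt g 0), ψ (pt g 1), ψ (pt g 2))` (`6³` permutation triples) and the reduced sum `T0`
  (block `0` in natural order, `36` terms); **`Tgen_eq_six_mul_T0`** for symmetric kernels (`IsSym3`; `s6H`, `s6G`, `s6T` are symmetric), by re-indexing
  `(j, k) ↦ (j·i⁻¹, k·i⁻¹)` (`dv`, `pt_reindex`).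
* §3 **`comb_of_Tgen`**: `(∀ ψ monotone, 0 ≤ Tgen κ ψ) → (H2)`.  For a blockwise sorted class `c` the rearrangement sum of `…ChainCombSorted` is, up to the positive factor
  `Π_b stab (c b)` (orbit counting, `sum_perm_eq_mul_sum_rearrI`), the generic sum of the PULLED-BACK map `pull (psiOf G) c` (again monotone), `KC_eq_term`.
* §4 petal renaming: transpositions of two petals preserve monotonicity and `T0` (`IsPetalInv`); **`exists_good`**: every monotone map has a renaming that is GOOD
  along a given cell sequence (every value in `{2,3}` is preceded by a `1`, every `3` by a `2`) — the symmetry reduction used by the search.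
-/

namespace Summit.CriticalPhenomena.PercolationContinuityZ3.Theorems.SunflowerPartition

open Finset

namespace ThreeBlockComb

open ChainComb

/-! ## §1. Level vectors, staircases and the quotient map of a height-two three-block quotient -/

/-- Level vectors of the height-two three-block threshold set: one level `0, 1, 2` per block. [this work] -/
abbrev Lv : Type := Fin 3 → Fin 3

/-- The staircase subset of the threshold set with `v b` thresholds on in block `b`. [this work] -/
def stair (v : Lv) : Finset (Σ _b : Fin 3, Fin 2) := univ.filter fun x => x.2.val < (v x.1).val

/-- Staircases are monotone in the level vector. [this work] -/
theorem stair_mono {v w : Lv} (h : v ≤ w) : stair v ⊆ stair w := by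
  intro x hx
  simp only [stair, mem_filter, mem_univ, true_and] at hx ⊢
  exact lt_of_lt_of_le hx (Fin.le_def.1 (h x.1))

/-- The QUOTIENT MAP of a height-two three-block quotient: the `M₃`-label of each staircase. [this work] -/
def psiOf (G : Sunflower (Σ _b : Fin 3, Fin 2)) (v : Lv) : Fin 5 := G.lab (stair v)

/-- The order of the diamond `M₃` on `Fin 5` (`0` bottom, `4` top, `1,2,3` incomparable petals), as a Boolean. [this work] -/
def mleB (a b : Fin 5) : Bool := a == b || a == 0 || b == 4

/-- `mleB` is the diamond order. [this work] -/
theorem mleB_eq_true : ∀ a b : Fin 5, mleB a b = true ↔ (a = b ∨ a = 0 ∨ b = 4) := by decide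

/-- Monotone maps `[3]³ → M₃`. [this work] -/
def IsMonoM3 (ψ : Lv → Fin 5) : Prop := ∀ ⦃v w : Lv⦄, v ≤ w → mleB (ψ v) (ψ w) = true

/-- The quotient map of a sunflower quotient is monotone (`Sunflower.lab_mono`). [this work] -/
theorem psiOf_mono (G : Sunflower (Σ _b : Fin 3, Fin 2)) : IsMonoM3 (psiOf G) := fun _ _ h =>
  (mleB_eq_true _ _).2 (G.lab_mono (stair_mono h))

/-! ## §2. Generic transversal sums -/

/-- Point `m` of the transversal triple indexed by a permutation triple `g`: levels `(perm3f (g b) m)_b`. [this work] -/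
def pt (g : Fin 3 → Fin 6) (m : Fin 3) : Lv := fun b => perm3f (g b) m

/-- The kernel evaluated on the labels of a transversal triple. [this work] -/
def term (κ : Fin 5 → Fin 5 → Fin 5 → ℤ) (ψ : Lv → Fin 5) (g : Fin 3 → Fin 6) : ℤ :=
  κ (ψ (pt g 0)) (ψ (pt g 1)) (ψ (pt g 2))

/-- The GENERIC CLASS SUM of `ψ`: the kernel over all `6³` permutation triples. [this work] -/
def Tgen (κ : Fin 5 → Fin 5 → Fin 5 → ℤ) (ψ : Lv → Fin 5) : ℤ := ∑ g : Fin 3 → Fin 6, term κ ψ g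

/-- The REDUCED generic sum: block `0` read in its natural order (`36` terms). [this work] -/
def T0 (κ : Fin 5 → Fin 5 → Fin 5 → ℤ) (ψ : Lv → Fin 5) : ℤ := ∑ j : Fin 6, ∑ k : Fin 6, term κ ψ ![0, j, k]

/-- `dv j i`: the index of the permutation `perm3f j ∘ (perm3f i)⁻¹`. [this work] -/
def dv : Fin 6 → Fin 6 → Fin 6 :=
  ![![0, 1, 2, 3, 5, 4], ![1, 0, 5, 4, 2, 3], ![2, 4, 0, 5, 3, 1], ![3, 5, 4, 0, 1, 2], ![4, 2, 3, 1, 0, 5], ![5, 3, 1, 2, 4, 0]]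

/-- `mr j i`: the index of the permutation `perm3f j ∘ perm3f i`. [this work] -/
def mr : Fin 6 → Fin 6 → Fin 6 :=
  ![![0, 1, 2, 3, 4, 5], ![1, 0, 5, 4, 3, 2], ![2, 4, 0, 5, 1, 3], ![3, 5, 4, 0, 2, 1], ![4, 2, 3, 1, 5, 0], ![5, 3, 1, 2, 0, 4]]

/-- `dv ∘ mr = id` in the first argument. [this work] -/
theorem dv_mr : ∀ j i : Fin 6, dv (mr j i) i = j := by decide

/-- `mr ∘ dv = id` in the first argument. [this work] -/
theorem mr_dv : ∀ j i : Fin 6, mr (dv j i) i = j := by decide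

/-- Right translation by `(perm3f i)⁻¹` as a bijection of the indices. [this work] -/
def dvEquiv (i : Fin 6) : Fin 6 ≃ Fin 6 where
  toFun j := dv j i
  invFun j := mr j i
  left_inv j := mr_dv j i
  right_inv j := dv_mr j i

/-- Re-indexing a transversal triple so that block `0` is read in natural order permutes its three points by `perm3f i`. [this work] -/
theorem pt_reindex : ∀ (i j k : Fin 6) (m : Fin 3), pt ![i, j, k] m = pt ![0, dv j i, dv k i] (perm3f i m) := by
  decide

/-- Full symmetry of a kernel under the six permutations of its arguments (value-table form). [this work] -/
def IsSym3 (κ : Fin 5 → Fin 5 → Fin 5 → ℤ) : Prop :=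
  ∀ (i : Fin 6) (a b c : Fin 5), κ (![a, b, c] (perm3f i 0)) (![a, b, c] (perm3f i 1)) (![a, b, c] (perm3f i 2)) = κ a b c

/-- `s6H` is fully symmetric. [this work] -/
theorem isSym3_s6H : IsSym3 s6H := by unfold IsSym3; decide
/-- `s6G` is fully symmetric. [this work] -/
theorem isSym3_s6G : IsSym3 s6G := by unfold IsSym3; decide
/-- `s6T` is fully symmetric. [this work] -/
theorem isSym3_s6T : IsSym3 s6T := by unfold IsSym3; decide

/-- A symmetric kernel does not see a permutation of a triple of arguments. [this work] -/
theorem isSym3_apply {κ : Fin 5 → Fin 5 → Fin 5 → ℤ} (hκ : IsSym3 κ) (f : Fin 3 → Fin 5) (i : Fin 6) :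
    κ (f (perm3f i 0)) (f (perm3f i 1)) (f (perm3f i 2)) = κ (f 0) (f 1) (f 2) := by
  have e : ![f 0, f 1, f 2] = f := by
    funext m; fin_cases m <;> rfl
  have h := hκ i (f 0) (f 1) (f 2)
  rw [e] at h
  exact h

/-- Re-indexing a term so that block `0` is read in natural order. [this work] -/
theorem term_reindex {κ : Fin 5 → Fin 5 → Fin 5 → ℤ} (hκ : IsSym3 κ) (ψ : Lv → Fin 5) (i j k : Fin 6) :
    term κ ψ ![i, j, k] = term κ ψ ![0, dv j i, dv k i] := by
  unfold term
  rw [pt_reindex i j k 0, pt_reindex i j k 1, pt_reindex i j k 2]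
  exact isSym3_apply hκ (fun m => ψ (pt ![0, dv j i, dv k i] m)) i

/-- `(Fin 3 → Fin 6) ≃ Fin 6 × (Fin 6 × Fin 6)`. [folklore] -/
def arrow3Equiv : (Fin 3 → Fin 6) ≃ Fin 6 × (Fin 6 × Fin 6) where
  toFun g := (g 0, g 1, g 2)
  invFun p := ![p.1, p.2.1, p.2.2]
  left_inv g := by funext m; fin_cases m <;> rfl
  right_inv _ := rfl

/-- A sum over `Fin 3 → Fin 6` as an iterated sum. [folklore] -/
theorem sum_arrow3 {M : Type*} [AddCommMonoid M] (F : (Fin 3 → Fin 6) → M) :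
    ∑ g, F g = ∑ i, ∑ j, ∑ k, F ![i, j, k] := by
  rw [Fintype.sum_equiv arrow3Equiv F (fun q => F ![q.1, q.2.1, q.2.2]) (fun g => ?_)]
  · rw [Fintype.sum_prod_type]
    exact Finset.sum_congr rfl fun i _ => Fintype.sum_prod_type _
  · show F g = F ![g 0, g 1, g 2]
    congr 1
    funext m; fin_cases m <;> rfl

/-- **`Tgen = 6 · T0`** for a symmetric kernel. [this work] -/
theorem Tgen_eq_six_mul_T0 {κ : Fin 5 → Fin 5 → Fin 5 → ℤ} (hκ : IsSym3 κ) (ψ : Lv → Fin 5) : Tgen κ ψ = 6 * T0 κ ψ := by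
  unfold Tgen T0
  rw [sum_arrow3]
  have inner : ∀ i : Fin 6, ∑ j, ∑ k, term κ ψ ![i, j, k] = ∑ j, ∑ k, term κ ψ ![0, j, k] := by
    intro i
    rw [Finset.sum_congr rfl fun j _ => Finset.sum_congr rfl fun k _ => term_reindex hκ ψ i j k]
    exact Fintype.sum_equiv (dvEquiv i) _ _ fun j => Fintype.sum_equiv (dvEquiv i) _ _ fun k => rfl
  rw [Finset.sum_congr rfl fun i _ => inner i, Finset.sum_const, card_univ, Fintype.card_fin]
  simp

/-! ## §3. From the generic class of the pulled-back map to every sorted class -/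

/-- The number of the six rearrangements fixing a triple. [this work] -/
def stab (u : Fin 3 → Fin 3) : ℕ := #(univ.filter fun i : Fin 6 => u ∘ perm3f i = u)

/-- The stabiliser is nonempty. [this work] -/
theorem stab_pos : ∀ u : Fin 3 → Fin 3, 0 < stab u := by
  unfold stab; decide

/-- Every fibre of `i ↦ u ∘ perm3f i` over its image has `stab u` elements. [this work] -/
theorem card_fiber : ∀ (u : Fin 3 → Fin 3) (j : Fin 6),
    #(univ.filter fun i : Fin 6 => u ∘ perm3f i = u ∘ perm3f j) = stab u := by
  unfold stab; decide

/-- **Orbit counting**: the sum over all permutation triples is `Π_b stab (c b)` times the sum over the blockwise rearrangements. [this work] -/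
theorem sum_perm_eq_mul_sum_rearrI (F : (∀ _b : Fin 3, Fin 3 → Fin 3) → ℤ) (c : ∀ _b : Fin 3, Fin 3 → Fin 3) :
    ∑ g : Fin 3 → Fin 6, F (fun b => c b ∘ perm3f (g b)) =
      (∏ b, (stab (c b) : ℤ)) * ∑ L ∈ Fintype.piFinset (fun b => rearrI (c b)), F L := by
  rw [Finset.sum_comp F (fun g : Fin 3 → Fin 6 => fun b => c b ∘ perm3f (g b))]
  have himg : (univ : Finset (Fin 3 → Fin 6)).image (fun g => fun b => c b ∘ perm3f (g b)) =
      Fintype.piFinset (fun b => rearrI (c b)) := by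
    unfold rearrI
    rw [Fintype.piFinset_image (fun b (i : Fin 6) => c b ∘ perm3f i) (fun _ => univ), Fintype.piFinset_univ]
  rw [himg]
  have hfib : ∀ L ∈ Fintype.piFinset (fun b => rearrI (c b)),
      #(univ.filter fun g : Fin 3 → Fin 6 => (fun b => c b ∘ perm3f (g b)) = L) = ∏ b, stab (c b) := by
    intro L hL
    rw [Fintype.mem_piFinset] at hL
    have hset : (univ.filter fun g : Fin 3 → Fin 6 => (fun b => c b ∘ perm3f (g b)) = L) =
        Fintype.piFinset (fun b => univ.filter fun i : Fin 6 => c b ∘ perm3f i = L b) := by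
      ext g
      simp only [mem_filter, mem_univ, true_and, Fintype.mem_piFinset]
      exact funext_iff
    rw [hset, Fintype.card_piFinset]
    refine prod_congr rfl fun b _ => ?_
    obtain ⟨j, _, hj⟩ := mem_image.1 (hL b)
    rw [← hj]
    exact card_fiber (c b) j
  rw [Finset.sum_congr rfl fun L hL => show _ = (∏ b, stab (c b)) • F L by rw [hfib L hL], ← Finset.smul_sum,
    nsmul_eq_mul, Nat.cast_prod]

/-- Nonnegativity transfers from the permutation-triple sum to the rearrangement sum. [this work] -/
theorem sum_piFinset_nonneg (F : (∀ _b : Fin 3, Fin 3 → Fin 3) → ℤ) (c : ∀ _b : Fin 3, Fin 3 → Fin 3)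
    (h : 0 ≤ ∑ g : Fin 3 → Fin 6, F (fun b => c b ∘ perm3f (g b))) :
    0 ≤ ∑ L ∈ Fintype.piFinset (fun b => rearr (c b)), F L := by
  have e : (fun b => rearr (c b)) = fun b => rearrI (c b) := funext fun b => (rearrI_eq _).symm
  rw [e]
  rw [sum_perm_eq_mul_sum_rearrI] at h
  have hpos : (0 : ℤ) < ∏ b, (stab (c b) : ℤ) := prod_pos fun b _ => by exact_mod_cast stab_pos (c b)
  exact (mul_nonneg_iff_of_pos_left hpos).1 h

/-- Pulling a map back along monotone level maps, one per block. [this work] -/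
def pull (ψ : Lv → Fin 5) (c : ∀ _b : Fin 3, Fin 3 → Fin 3) : Lv → Fin 5 := fun v => ψ (fun b => c b (v b))

/-- The pull-back of a monotone map along monotone level maps is monotone. [this work] -/
theorem pull_mono {ψ : Lv → Fin 5} (hψ : IsMonoM3 ψ) {c : ∀ _b : Fin 3, Fin 3 → Fin 3} (hc : ∀ b, Monotone (c b)) :
    IsMonoM3 (pull ψ c) :=
  fun _ _ hvw => hψ fun b => hc b (hvw b)

/-- The kernel value of a rearranged class family is a transversal term of the pulled-back quotient map. [this work] -/
theorem KC_eq_term (κ : Fin 5 → Fin 5 → Fin 5 → ℤ) (G : Sunflower (Σ _b : Fin 3, Fin 2)) (c : ∀ _b : Fin 3, Fin 3 → Fin 3)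
    (g : Fin 3 → Fin 6) : KC κ G (fun b => c b ∘ perm3f (g b)) = term κ (pull (psiOf G) c) g := rfl

/-- **COMB_chain of a height-two three-block quotient from the generic sums of all monotone maps.** [this work] -/
theorem comb_of_Tgen (κ : Fin 5 → Fin 5 → Fin 5 → ℤ) (hT : ∀ ψ : Lv → Fin 5, IsMonoM3 ψ → 0 ≤ Tgen κ ψ)
    (G : Sunflower (Σ b : Fin 3, Fin (two (Fin 3) b))) :
    ∀ c : (∀ b : Fin 3, Fin 3 → Fin (two (Fin 3) b + 1)), 0 ≤ ZFC κ G c := by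
  refine comb_chain_of_sorted κ G fun c hc => ?_
  refine sum_piFinset_nonneg (fun L => KC κ G L) c ?_
  have h := hT (pull (psiOf G) c) (pull_mono (psiOf_mono G) hc)
  unfold Tgen at h
  exact h

/-! ## §4. Petal renaming -/

/-- The transposition of two values of `Fin 5`. [this work] -/
def sw (a c x : Fin 5) : Fin 5 := if x = a then c else if x = c then a else x

/-- Invariance of a kernel under transpositions of two petals. [this work] -/
def IsPetalInv (κ : Fin 5 → Fin 5 → Fin 5 → ℤ) : Prop :=
  ∀ a c : Fin 5, (a ≠ 0 ∧ a ≠ 4) → (c ≠ 0 ∧ c ≠ 4) → ∀ x y z : Fin 5, κ (sw a c x) (sw a c y) (sw a c z) = κ x y z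

/-- `s6H` is invariant under petal renaming. [this work] -/
theorem isPetalInv_s6H : IsPetalInv s6H := by unfold IsPetalInv sw; decide
/-- `s6G` is invariant under petal renaming. [this work] -/
theorem isPetalInv_s6G : IsPetalInv s6G := by unfold IsPetalInv sw; decide
/-- `s6T` is invariant under petal renaming. [this work] -/
theorem isPetalInv_s6T : IsPetalInv s6T := by unfold IsPetalInv sw; decide

/-- A petal transposition preserves the diamond order. [this work] -/
theorem mleB_sw : ∀ a c : Fin 5, (a ≠ 0 ∧ a ≠ 4) → (c ≠ 0 ∧ c ≠ 4) → ∀ x y : Fin 5, mleB (sw a c x) (sw a c y) = mleB x y := by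
  unfold sw; decide

/-- A petal transposition preserves monotonicity. [this work] -/
theorem mono_sw {a c : Fin 5} (ha : a ≠ 0 ∧ a ≠ 4) (hc : c ≠ 0 ∧ c ≠ 4) {ψ : Lv → Fin 5} (hψ : IsMonoM3 ψ) :
    IsMonoM3 (fun v => sw a c (ψ v)) := by
  intro v w hvw
  rw [mleB_sw a c ha hc]
  exact hψ hvw

/-- A petal transposition preserves the reduced generic sum of an invariant kernel. [this work] -/
theorem T0_sw {κ : Fin 5 → Fin 5 → Fin 5 → ℤ} (hκ : IsPetalInv κ) {a c : Fin 5} (ha : a ≠ 0 ∧ a ≠ 4) (hc : c ≠ 0 ∧ c ≠ 4)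
    (ψ : Lv → Fin 5) : T0 κ (fun v => sw a c (ψ v)) = T0 κ ψ := by
  unfold T0 term
  exact Finset.sum_congr rfl fun j _ => Finset.sum_congr rfl fun k _ => hκ a c ha hc _ _ _

/-- FIRST-OCCURRENCE NORMALISATION along a sequence of cells: after a suitable transposition `sw t c` with `S c`, every `S`-value other than `t`
is preceded by an occurrence of `t`. [this work] -/
theorem normalize (cell : ℕ → Lv) (S : Fin 5 → Prop) [DecidablePred S] (t : Fin 5) (hSt : S t)
    (hS : ∀ c, S c → ∀ x, S (sw t c x) ↔ S x) (hcc : ∀ c, sw t c c = t) (ψ : Lv → Fin 5) :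
    ∃ c, S c ∧ ∀ d < 27, S (sw t c (ψ (cell d))) → sw t c (ψ (cell d)) ≠ t → ∃ e < d, sw t c (ψ (cell e)) = t := by
  by_cases hex : ∃ d, d < 27 ∧ S (ψ (cell d))
  · have hd₀ : Nat.find hex < 27 ∧ S (ψ (cell (Nat.find hex))) := Nat.find_spec hex
    refine ⟨ψ (cell (Nat.find hex)), hd₀.2, fun d hd hSd hne => ?_⟩
    have hSd' : S (ψ (cell d)) := (hS _ hd₀.2 _).1 hSd
    have hle : Nat.find hex ≤ d := Nat.find_min' hex ⟨hd, hSd'⟩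
    rcases hle.eq_or_lt with heq | hlt
    · exact absurd (heq ▸ hcc _) hne
    · exact ⟨Nat.find hex, hlt, hcc _⟩
  · refine ⟨t, hSt, fun d hd hSd _ => ?_⟩
    exact absurd ⟨d, hd, (hS t hSt _).1 hSd⟩ hex

/-- Petal values. [this work] -/
theorem sw_petal_iff : ∀ c : Fin 5, (c ≠ 0 ∧ c ≠ 4) → ∀ x : Fin 5, (sw 1 c x ≠ 0 ∧ sw 1 c x ≠ 4) ↔ (x ≠ 0 ∧ x ≠ 4) := by
  unfold sw; decide
/-- Values in `{2, 3}`. [this work] -/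
theorem sw_23_iff : ∀ c : Fin 5, (c = 2 ∨ c = 3) → ∀ x : Fin 5, (sw 2 c x = 2 ∨ sw 2 c x = 3) ↔ (x = 2 ∨ x = 3) := by
  unfold sw; decide
/-- `sw t c c = t`. [this work] -/
theorem sw_self : ∀ t c : Fin 5, sw t c c = t := by
  unfold sw; decide
/-- A transposition inside `{2, 3}` fixes `1`. [this work] -/
theorem sw_2c_one : ∀ c : Fin 5, (c = 2 ∨ c = 3) → sw 2 c 1 = 1 := by
  unfold sw; decide

/-- GOOD maps along a cell sequence: monotone, every value in `{2,3}` preceded by a `1`, every `3` preceded by a `2` (canonical petal names). [this work] -/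
def IsGood (cell : ℕ → Lv) (ψ : Lv → Fin 5) : Prop :=
  IsMonoM3 ψ ∧ (∀ d < 27, (ψ (cell d) = 2 ∨ ψ (cell d) = 3) → ∃ e < d, ψ (cell e) = 1) ∧
    (∀ d < 27, ψ (cell d) = 3 → ∃ e < d, ψ (cell e) = 2)

/-- **Every monotone map has a good petal renaming with the same reduced generic sums.** [this work] -/
theorem exists_good (cell : ℕ → Lv) (ψ : Lv → Fin 5) (hψ : IsMonoM3 ψ) :
    ∃ ψ' : Lv → Fin 5, IsGood cell ψ' ∧ ∀ κ, IsPetalInv κ → T0 κ ψ' = T0 κ ψ := by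
  -- step 1: the first petal is renamed `1`
  obtain ⟨c, hc, h1⟩ := normalize cell (fun x => x ≠ 0 ∧ x ≠ 4) 1 (by decide) sw_petal_iff (sw_self 1) ψ
  -- step 2: the first petal other than `1` is renamed `2`
  obtain ⟨c', hc', h2⟩ :=
    normalize cell (fun x => x = 2 ∨ x = 3) 2 (by decide) sw_23_iff (sw_self 2) (fun v => sw 1 c (ψ v))
  have hc'pet : c' ≠ 0 ∧ c' ≠ 4 := by
    rcases hc' with h | h <;> rw [h] <;> decide
  refine ⟨fun v => sw 2 c' (sw 1 c (ψ v)), ⟨?_, ?_, ?_⟩, ?_⟩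
  · exact mono_sw (by decide) hc'pet (mono_sw (by decide) hc hψ)
  · intro d hd h23
    beta_reduce at h23
    have h23' : sw 1 c (ψ (cell d)) = 2 ∨ sw 1 c (ψ (cell d)) = 3 := (sw_23_iff c' hc' _).1 h23
    have hpet : sw 1 c (ψ (cell d)) ≠ 0 ∧ sw 1 c (ψ (cell d)) ≠ 4 := by
      rcases h23' with h | h <;> rw [h] <;> decide
    have hne : sw 1 c (ψ (cell d)) ≠ 1 := by
      rcases h23' with h | h <;> rw [h] <;> decide
    obtain ⟨e, he, he1⟩ := h1 d hd hpet hne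
    refine ⟨e, he, ?_⟩
    show sw 2 c' (sw 1 c (ψ (cell e))) = 1
    rw [he1]
    exact sw_2c_one c' hc'
  · intro d hd h3
    beta_reduce at h3
    have hne : sw 2 c' (sw 1 c (ψ (cell d))) ≠ 2 := by
      rw [h3]; decide
    exact h2 d hd (Or.inr h3) hne
  · intro κ hκ
    rw [T0_sw hκ (by decide) hc'pet (fun v => sw 1 c (ψ v)), T0_sw hκ (by decide) hc ψ]

end ThreeBlockComb

end Summit.CriticalPhenomena.PercolationContinuityZ3.Theorems.SunflowerPartition
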